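import Mathlib
import HarnessLib
import Literature.MathematicalPhysics.QuantumLattice.HubbardWindowCertificateD4

/-!
# SymReplay checker — Part A (syntax): the word-form Ward × affine-`D₄` window-certificate CHECKER
(team lb-sym, cell hub-lb; Part A of `Cruxes/LowerEdge_ge_m83o100/Lines/symreplay.lean` rev 7 by hub-lb-sym-plan-1,
landed for import by hub-lb-sym-eng-3). Computable, kernel-reducible definitions only: raw ladder letters and words,
`ℚ`-polynomials, the CAR normal-orderer `nfWord`, the collector, the anchored affine-`D₄` canonicaliser `canonA`,
the cell's Hamiltonian / energy / density / spin polynomials at `(t,t',U,n) = (1,0,8,7/8)`, the certificate record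
`SymCert` (SOS Gram `gram`, matrix Gram `gramM`), `symValue`, and the Boolean checker `symCheck`; kernel demos.
No summit statement is proved here; nothing here predicts superconductivity.
-/

namespace Summit.Ventures.CertifiedManyBodySolver.Theorems.SymReplay

open Literature.Probability.LatticeModels (Site)

/-! ## Part A — the syntactic layer (computable; kernel-reducible) -/

section Syntax

/-- Boolean equality of sites of `ℤ²` (coordinatewise; the checker never calls the `Fintype`-based
`DecidableEq (Fin 2 → ℤ)`). -/
def siteEq (x y : Site 2) : Bool := x 0 == y 0 && x 1 == y 1

/-- Lexicographic comparison of sites. -/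
def siteLt (x y : Site 2) : Bool := decide (x 0 < y 0) || (x 0 == y 0 && decide (x 1 < y 1))

/-- A raw ladder letter: site, spin (`0 = ↑`, `1 = ↓`), dagger flag (`true` = creation `c†`). -/
structure Letter where
  x : Site 2
  s : Fin 2
  dag : Bool

/-- Same orbital `(x, σ)`. -/
def Letter.modeEq (a b : Letter) : Bool := siteEq a.x b.x && a.s == b.s

/-- Mode order: site lexicographic, then spin. -/
def Letter.modeLt (a b : Letter) : Bool := siteLt a.x b.x || (siteEq a.x b.x && decide (a.s.val < b.s.val))

/-- Equality of letters. -/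
def Letter.beq (a b : Letter) : Bool := a.modeEq b && a.dag == b.dag

/-- Letter order (creators before annihilators of the same mode). -/
def Letter.blt (a b : Letter) : Bool := a.modeLt b || (a.modeEq b && a.dag && !b.dag)

/-- The adjoint letter. -/
def Letter.adj (a : Letter) : Letter := ⟨a.x, a.s, !a.dag⟩

/-- `c†_{xσ}`. -/
def cre (x : Site 2) (σ : Fin 2) : Letter := ⟨x, σ, true⟩

/-- `c_{xσ}`. -/
def ann (x : Site 2) (σ : Fin 2) : Letter := ⟨x, σ, false⟩

/-- A word `ℓ₁ ⋯ ℓ_k` (product in list order). -/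
abbrev Word := List Letter

/-- A formal `ℚ`-linear combination of words (unnormalised association list; its meaning is the sum). -/
abbrev QPoly := List (ℚ × Word)

/-- Equality of words. -/
def wordEq : Word → Word → Bool
  | [], [] => true
  | a :: u, b :: v => a.beq b && wordEq u v
  | _, _ => false

/-- Lexicographic order of words (shorter prefix first). -/
def wordLt : Word → Word → Bool
  | [], [] => false
  | [], _ :: _ => true
  | _ :: _, [] => false
  | a :: u, b :: v => a.blt b || (a.beq b && wordLt u v)

/-- Prefix the letter `m` to every word, flipping the sign of every coefficient. -/
def consNeg (m : Letter) (p : QPoly) : QPoly := p.map fun t => (-t.1, m :: t.2)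

/-- **The CAR normal-ordering kernel.**  Left-multiply the (normal-ordered) word `u` by the letter `ℓ`:
creators are inserted into the sorted creator block with a sign per transposition (`c†c† = −c†c†`,
`(c†)² = 0`), annihilators are moved right through the creators by `c_i c†_j = δ_ij − c†_j c_i` and then
inserted into the sorted annihilator block.  Structural recursion on `u`. -/
def insL (ℓ : Letter) : Word → QPoly
  | [] => [(1, [ℓ])]
  | m :: rest =>
    if ℓ.dag then
      if m.dag then
        if ℓ.modeEq m then [] else if ℓ.modeLt m then [(1, ℓ :: m :: rest)] else consNeg m (insL ℓ rest)
      else [(1, ℓ :: m :: rest)]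
    else
      if m.dag then
        (if ℓ.modeEq m then [((1 : ℚ), rest)] else []) ++ consNeg m (insL ℓ rest)
      else
        if ℓ.modeEq m then [] else if ℓ.modeLt m then [(1, ℓ :: m :: rest)] else consNeg m (insL ℓ rest)

/-- Normal form of a word: a signed sum of normal-ordered words (creators first, each block sorted). -/
def nfWord : Word → QPoly
  | [] => [(1, [])]
  | ℓ :: w => (nfWord w).flatMap fun t => (insL ℓ t.2).map fun t' => (t.1 * t'.1, t'.2)

/-- Scalar multiple. -/
def pscale (q : ℚ) (p : QPoly) : QPoly := p.map fun t => (q * t.1, t.2)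

/-- Difference `p − r` (unnormalised). -/
def psub (p r : QPoly) : QPoly := p ++ pscale (-1) r

/-- Normal form of a polynomial (termwise `nfWord`, unnormalised). -/
def nfPoly (p : QPoly) : QPoly := p.flatMap fun t => pscale t.1 (nfWord t.2)

/-- Product (concatenation of words). -/
def pmul (p r : QPoly) : QPoly := p.flatMap fun t => r.map fun t' => (t.1 * t'.1, t.2 ++ t'.2)

/-- Adjoint word (reverse, flip daggers). -/
def adjWord (w : Word) : Word := (w.map Letter.adj).reverse

/-- Adjoint polynomial (rational coefficients are self-conjugate). -/
def padj (p : QPoly) : QPoly := p.map fun t => (t.1, adjWord t.2)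

/-- Commutator `p r − r p`. -/
def comm (p r : QPoly) : QPoly := psub (pmul p r) (pmul r p)

/-! #### Collector = sym-ref-1's fuel-structural sort-merge `collect2` (rev 4; copied VERBATIM from
`pub/hub-lb/hub-lb-sym-ref-1/engine/Collect2Sound.lean` sha16 b84e4d3d70e5e0b2, checklist L3 (a), crit-1 V57;
only the final name is `collect` here so `isZero`/`identityOK` are unchanged).  Every recursion is structural
(reduces under `decide +kernel`; measured by sym-ref-1: e2e 1 000 products 9.2 s kernel, 2×10⁵ / 10⁶ products
15.4 s / 59 s interpreted with packed letters).  Rev 3's own merge sort (splitAlt/msortFuel) is superseded because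
this one comes with its SOUNDNESS lemmas (`collect_eval`, `isZero_sound` below, also verbatim). -/

/-- Merge two `wordLt`-sorted polynomials; `fuel ≥ |p| + |q|`. Structural on `fuel`. -/
def mergeF : ℕ → QPoly → QPoly → QPoly
  | 0, p, q => p ++ q
  | _ + 1, [], q => q
  | _ + 1, t :: p, [] => t :: p
  | n + 1, t :: p, t' :: q => if wordLt t'.2 t.2 then t' :: mergeF n (t :: p) q else t :: mergeF n p (t' :: q)

/-- One bottom-up round: merge adjacent runs. Structural on the list of runs. -/
def mergePairs (n : ℕ) : List QPoly → List QPoly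
  | p :: q :: rest => mergeF n p q :: mergePairs n rest
  | l => l

/-- Bottom-up merge sort driver; `rounds ≥ log₂ #runs` suffices (we pass `#runs`). Structural on `rounds`. -/
def mergeAll : ℕ → ℕ → List QPoly → QPoly
  | _, _, [] => []
  | _, _, [p] => p
  | 0, _, l => l.foldr (· ++ ·) []
  | k + 1, n, l => mergeAll k n (mergePairs n l)

/-- Sort a polynomial's terms by `wordLt` (stable). -/
def sortW (p : QPoly) : QPoly := mergeAll p.length p.length (p.map fun t => [t])

/-- Merge ADJACENT equal words (one pass, structural). -/
def mergeAdj : QPoly → QPoly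
  | [] => []
  | t :: rest =>
    match mergeAdj rest with
    | [] => [t]
    | t' :: rest' => if wordEq t.2 t'.2 then (t.1 + t'.1, t.2) :: rest' else t :: t' :: rest'

/-- Merge equal words: sort by `wordLt`, then add adjacent runs (= sym-ref-1's `collect2`). -/
def collect (p : QPoly) : QPoly := mergeAdj (sortW p)

/-- All coefficients vanish after collection. -/
def isZero (p : QPoly) : Bool := (collect p).all fun t => decide (t.1 = 0)

/-- `|q|`. -/
def qabs (q : ℚ) : ℚ := if q < 0 then -q else q

/-! ### Sites, supports, neighbourhoods -/

/-- `x ∈ S`. -/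
def memSite (x : Site 2) (S : List (Site 2)) : Bool := S.any (siteEq x)

/-- `S ⊆ T`. -/
def subSites (S T : List (Site 2)) : Bool := S.all fun x => memSite x T

/-- No repeated site. -/
def nodupSites : List (Site 2) → Bool
  | [] => true
  | x :: S => !(memSite x S) && nodupSites S

/-- Every letter of `w` sits in `S`. -/
def suppIn (w : Word) (S : List (Site 2)) : Bool := w.all fun ℓ => memSite ℓ.x S

/-- Every word of `p` is supported in `S`. -/
def psuppIn (p : QPoly) (S : List (Site 2)) : Bool := p.all fun t => suppIn t.2 S

/-- The unit steps `e₁ = (1,0)`, `e₂ = (0,1)`. -/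
def e1 : Site 2 := ![1, 0]

/-- `e₂`. -/
def e2 : Site 2 := ![0, 1]

/-- The `3 × 3` sup-metric ball `x + {−1,0,1}²` (`= thicken {x} 1`). -/
def nbhd (x : Site 2) : List (Site 2) :=
  [(-1 : ℤ), 0, 1].flatMap fun a => [(-1 : ℤ), 0, 1].map fun b => x + ![a, b]

/-- `thicken S 1` as a list. -/
def thick (S : List (Site 2)) : List (Site 2) := S.flatMap nbhd

/-! ### Affine `D₄` moves -/

/-- The linear `D₄` action on `ℤ²`, written exactly as the tree's `d4Vec` (`rot (a,b) = (−b,a)`,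
`refl (a,b) = (a,−b)`, `r i ↦ rotⁱ`, `sr i ↦ refl ∘ rotⁱ`); see `d4R_eq_d4Vec`. -/
def d4R : DihedralGroup 4 → Site 2 → Site 2
  | .r i, e => (fun v : Site 2 => (![-v 1, v 0] : Site 2))^[i.val] e
  | .sr i, e => (fun v : Site 2 => (![v 0, -v 1] : Site 2))
      ((fun v : Site 2 => (![-v 1, v 0] : Site 2))^[i.val] e)

/-- The eight elements of `D₄`. -/
def d4All : List (DihedralGroup 4) :=
  [.r 0, .r 1, .r 2, .r 3, .sr 0, .sr 1, .sr 2, .sr 3]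

/-- `x ↦ γx + v`. -/
def moveSite (γ : DihedralGroup 4) (v : Site 2) (x : Site 2) : Site 2 := d4R γ x + v

/-- Letterwise move of a word (order of letters kept). -/
def moveWord (γ : DihedralGroup 4) (v : Site 2) (w : Word) : Word :=
  w.map fun ℓ => ⟨moveSite γ v ℓ.x, ℓ.s, ℓ.dag⟩

/-- `(γ, v)` is licensed by the window: `γ·inner + v ⊆ frame` (= `d4ShiftSet γ v Λ ⊆ Λ'`). -/
def licensedMove (inner frame : List (Site 2)) (γ : DihedralGroup 4) (v : Site 2) : Bool :=
  subSites (inner.map (moveSite γ v)) frame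

/-- Order on (normal forms of) monomials used to pick the canonical representative: compare leading words,
the zero polynomial first. -/
def polyKeyLt : QPoly → QPoly → Bool
  | [], [] => false
  | [], _ :: _ => true
  | _ :: _, [] => false
  | t :: _, t' :: _ => wordLt t.2 t'.2

/-! #### The anchored affine-`D₄` canonicaliser `canonA` (rev 5; replaces rev 1–4 `canonW`).
Two referee findings folded in: (sym-ref-2 l.982, kernel-tied Python model) `canonW` licensed its moves for
the whole INNER WINDOW, so its partition of words was SOUND but strictly FINER than the translation ⋊ `D₄`
orbits (a word's reachable images depended on where it sat inside `inner`) — FIX adopted here: license the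
move FOR THE WORD (`γ·supp u + v ⊆ frame`, i.e. the window lemma with `Λ := supp u`; no thickening is needed
for a pure identification), and ANCHOR: for each of the 8 point-group elements take the unique translate
putting the image's bounding-box corner on the frame's least corner ⇒ ≤ 8 candidates, result a function of
the orbit alone (translation ⋊ `D₄`-complete on box frames); (sym-ref-1 l.965/l.971, in-Lean profile) the
rev-3 `canonW` recomputed the 72-move licence table PER TERM (0.3 s/term interpreted) — gone: nothing here
depends on a move table, sites of moved letters are flattened to literals once (`flatSite`), and the frame
corner is computed once per certificate.  Sign-odd words (an image equal to `−`itself) canonicalise to `0`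
(sound: `u − w` and `u + w` both lie in the identification span ⇒ so does `u`). -/

/-- Force a site to a literal vector (cuts closure chains in the evaluator); `flatSite x = x`. -/
def flatSite (x : Site 2) : Site 2 := ![x 0, x 1]

/-- `moveWord` with flattened sites (same function, see `moveWordF_eq`). -/
def moveWordF (γ : DihedralGroup 4) (v : Site 2) (w : Word) : Word :=
  w.map fun ℓ => ⟨flatSite (moveSite γ v ℓ.x), ℓ.s, ℓ.dag⟩

/-- Componentwise minimum ("bounding-box corner") of a site list (junk `0` on `[]`). -/
def minCorner : List (Site 2) → Site 2
  | [] => 0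
  | [x] => flatSite x
  | x :: l => let m := minCorner l; ![min (x 0) (m 0), min (x 1) (m 1)]

/-- The sites of a word, in order. -/
def wordSites (w : Word) : List (Site 2) := w.map fun ℓ => ℓ.x

/-- The anchored normal forms of `u`: for each `γ ∈ D₄`, translate `γu` so that its bounding-box corner is the
frame corner `corner`; keep it iff the image lies in the frame (the move is then licensed for `supp u`). -/
def anchoredNFs (corner : Site 2) (frame : List (Site 2)) (u : Word) : List QPoly :=
  d4All.filterMap fun γ =>
    let v := flatSite (corner - minCorner (wordSites (moveWordF γ 0 u)))
    let w := moveWordF γ v u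
    if suppIn w frame then some (nfWord w) else none

/-- `c = −best` syntactically, term by term (same words, negated coefficients). -/
def polyNegEq : QPoly → QPoly → Bool
  | [], [] => true
  | t :: p, t' :: q => wordEq t.2 t'.2 && decide (t'.1 = -t.1) && polyNegEq p q
  | _, _ => false

/-- **The anchored affine-`D₄` canonicaliser (lb-sym lever).** The `polyKeyLt`-least anchored licensed image
of `u` (identity if none fits the frame); `0` if some image of `u` is syntactically `−`(the least one).  Each replacement
differs from `u` by identification terms `Γ(γY+v) − Γ(Y)`, `Y := u`, `d4ShiftSet γ v (supp u) ⊆ Λ'`, which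
vanish in the averaged window state — so the certificate ships no `Y`-family. -/
def canonA (corner : Site 2) (frame : List (Site 2)) (u : Word) : QPoly :=
  match anchoredNFs corner frame u with
  | [] => [(1, u)]
  | c :: cs =>
    let best := cs.foldl (fun b c' => if polyKeyLt c' b then c' else b) c
    if (c :: cs).any (polyNegEq best) then [] else best

/-- Canonicalise one term. -/
def canonTermA (corner : Site 2) (frame : List (Site 2)) (t : ℚ × Word) : QPoly :=
  pscale t.1 (canonA corner frame t.2)

/-! ### The cell's operators as polynomials, `(t, t', U, n) = (1, 0, 8, 7/8)` -/

/-- `q · Σ_σ (c†_{xσ} c_{yσ} + c†_{yσ} c_{xσ})`. -/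
def hop (q : ℚ) (x y : Site 2) : QPoly :=
  ([0, 1] : List (Fin 2)).flatMap fun σ => [(q, [cre x σ, ann y σ]), (q, [cre y σ, ann x σ])]

/-- `q · n_{x↑} n_{x↓} = q · c†_{x↑} c_{x↑} c†_{x↓} c_{x↓}`. -/
def onsite (q : ℚ) (x : Site 2) : QPoly := [(q, [cre x 0, ann x 0, cre x 1, ann x 1])]

/-- `H_{Λ'} = Σ_{x ∈ Λ'} 8 n_{x↑}n_{x↓} − Σ_{x, y ∈ Λ', y − x ∈ {e₁, e₂}} Σ_σ (c†_{xσ}c_{yσ} + h.c.)`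
(free boundary conditions, `t = 1`, `U = 8`, `t' = 0`). -/
def hamPoly (frame : List (Site 2)) : QPoly :=
  (frame.flatMap fun x => onsite 8 x) ++
    frame.flatMap fun x => frame.flatMap fun y =>
      if siteEq y (x + e1) || siteEq y (x + e2) then hop (-1) x y else []

/-- `E_Φ = 8 n_{0↑}n_{0↓} + ½ Σ_{y ∈ {±e₁, ±e₂}} (−1) Σ_σ (c†_{0σ}c_{yσ} + h.c.)` (mean energy per site). -/
def energyPoly : QPoly :=
  onsite 8 0 ++ hop (-1/2) 0 e1 ++ hop (-1/2) 0 e2 ++ hop (-1/2) (-e1) 0 ++ hop (-1/2) (-e2) 0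

/-- `n_{0σ}`. -/
def densPoly (σ : Fin 2) : QPoly := [(1, [cre 0 σ, ann 0 σ])]

/-- `S⁺_{Λ'} = Σ_x c†_{x↑} c_{x↓}`. -/
def spinPlusPoly (frame : List (Site 2)) : QPoly := frame.map fun x => (1, [cre x 0, ann x 1])

/-- `S⁻_{Λ'} = (S⁺)† = Σ_x c†_{x↓} c_{x↑}`. -/
def spinMinusPoly (frame : List (Site 2)) : QPoly := frame.map fun x => (1, [cre x 1, ann x 0])

/-- Particle charge `#c† − #c`. -/
def wordCharge (w : Word) : ℤ := (w.map fun ℓ => if ℓ.dag then (1 : ℤ) else -1).sum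

/-- `2S^z`-charge (as the tree's `ladderSpinCharge`). -/
def wordSpinCharge (w : Word) : ℤ :=
  (w.map fun ℓ => (if ℓ.dag then (1 : ℤ) else -1) * (if ℓ.s = 0 then 1 else -1)).sum

/-! ### The certificate record and the checker -/

/-- An explicit affine-`D₄` identification hint `z • (γu + v) − z • u` (optional; `canonA` makes them
unnecessary). -/
structure D4Move where
  z : ℚ
  u : Word
  γ : DihedralGroup 4
  v : Site 2

/-- Sparse exact dot product of two rows `[(ℓ, k)]` with STRICTLY ASCENDING column indices `k`
(merge; fuel-structural so that it reduces in the kernel). -/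
def sdotF : ℕ → List (ℚ × ℕ) → List (ℚ × ℕ) → ℚ → ℚ
  | 0, _, _, acc => acc
  | _ + 1, [], _, acc => acc
  | _ + 1, _, [], acc => acc
  | n + 1, (a, i) :: r, (b, j) :: r', acc =>
    if i < j then sdotF n r ((b, j) :: r') acc
    else if j < i then sdotF n ((a, i) :: r) r' acc
    else sdotF n r r' (acc + a * b)

/-- `⟨L_i, L_j⟩` for sparse ascending rows. -/
def sdot (r r' : List (ℚ × ℕ)) : ℚ := sdotF (r.length + r'.length) r r' 0

/-- A row is strictly ascending in its column indices. -/
def rowAsc : List (ℚ × ℕ) → Bool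
  | [] => true
  | [_] => true
  | (_, i) :: (b, j) :: r => decide (i < j) && rowAsc ((b, j) :: r)

/-- **One block of the Gram term in MATRIX form** (the format of record from rung v0′ upward — crit-1 V71 (B),
sym-eng-1 l.1060: SOS columns would cost `Σ_k s_k²` word products, dead at v0′): the operator
`scale · Σ_{i,j} ⟨L_i, L_j⟩ · q_i† q_j` with `q_i = basis[i]` (word polynomials with EXACT rational / integer
coefficients, consumed as given — no normalisation in the checker, sym-eng-1 l.1052 (c)) and `L_i = rows[i]`
a sparse exact row `[(ℓ_ik, k)]`, columns ascending.  It is PSD BY CONSTRUCTION — equal to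
`scale · Σ_k (Σ_i ℓ_ik q_i)† (Σ_i ℓ_ik q_i)` — so the checker tests only `0 ≤ scale`, row order and lengths, and
pays `Σ_{i,j} (s_i + s_j)` exact MACs plus ONE normal-ordered product per pair with `⟨L_i, L_j⟩ ≠ 0`.  A weighted
SOS factor `d • q†q` is the one-column block `(d, words of q, coefficient rows)`. -/
structure GramBlock where
  scale : ℚ
  basis : List QPoly
  rows : List (List (ℚ × ℕ))

/-- The word polynomial of a Gram block: `scale · Σ_{i,j : ⟨L_i,L_j⟩ ≠ 0} ⟨L_i, L_j⟩ · q_i† q_j`. -/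
def gramBlockPoly (B : GramBlock) : QPoly :=
  let qr := B.basis.zip B.rows
  pscale B.scale (qr.flatMap fun a => qr.flatMap fun b =>
    let g := sdot a.2 b.2
    if g = 0 then [] else pscale g (pmul (padj a.1) b.1))

/-- Side conditions of a Gram block: `0 ≤ scale`, one row per basis element, rows ascending, supports in the
frame. -/
def gramBlockOK (frame : List (Site 2)) (B : GramBlock) : Bool :=
  decide (0 ≤ B.scale) && B.basis.length == B.rows.length && B.rows.all rowAsc &&
    B.basis.all fun q => psuppIn q frame

/-- **A syntactic Ward × `D₄` window certificate** at the M3 cell.  `gram`: SOS factors `(d_k, q_k)`,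
meaning `Σ_k d_k • q_k† q_k` with `d_k ≥ 0` (an exact `LDLᵀ`/`LᴴL` factorisation done by the PRODUCER —
certc mode gram already emits this) — toys / V′ only; `gramM`: Gram blocks in MATRIX form (`GramBlock`, the format of
record from v0′ upward; default `[]`); `eom`: words `B_k` supported in `inner` (term `H_{Λ'}B − BH_{Λ'}`);
`moves`: explicit identification hints; `charged`: `b_j • w_j` with nonzero particle or spin charge;
`wardP`/`wardM`: `X_r` (terms `S⁺X − XS⁺`, `S⁻X' − X'S⁻`); `antiH`: `d • (V† − V)`; `slack`: `a_k • w_k`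
at price `|a_k|`; `useCanon`: quotient the identity check by the anchored canonicaliser `canonA` (per-word licensed
affine-`D₄` moves; `inner` then only carries the EOM words, whose commutator with `H_{frame}` needs `thick inner ⊆ frame`). -/
structure SymCert where
  frame : List (Site 2)
  inner : List (Site 2)
  mu : ℚ
  c : ℚ
  gram : List (ℚ × QPoly)
  gramM : List GramBlock := []
  eom : List QPoly
  moves : List D4Move
  charged : List (ℚ × Word)
  wardP : List QPoly
  wardM : List QPoly
  antiH : List (ℚ × QPoly)
  slack : List (ℚ × Word)
  useCanon : Bool

/-- The certified value `c − Σ_k |a_k|`. -/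
def symValue (K : SymCert) : ℚ := K.c - (K.slack.map fun t => qabs t.1).sum

/-- Left-hand side `E_Φ − c·1 − μ (n_{0↑} + n_{0↓} − 7/8)`. -/
def lhsPoly (K : SymCert) : QPoly :=
  energyPoly ++ [(-K.c, [])] ++ pscale (-K.mu) (densPoly 0 ++ densPoly 1 ++ [((-7) / 8, [])])

/-- Right-hand side: Gram SOS + Gram matrix blocks + EOM commutators + identification hints + charged words + Ward commutators
+ anti-Hermitian parts + slack words. -/
def rhsPoly (K : SymCert) : QPoly :=
  (K.gram.flatMap fun g => pscale g.1 (pmul (padj g.2) g.2)) ++ K.gramM.flatMap gramBlockPoly ++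
    (K.eom.flatMap fun B => comm (hamPoly K.frame) B) ++
    (K.moves.flatMap fun mv => [(mv.z, moveWord mv.γ mv.v mv.u), (-mv.z, mv.u)]) ++
    K.charged ++
    (K.wardP.flatMap fun X => comm (spinPlusPoly K.frame) X) ++
    (K.wardM.flatMap fun X => comm (spinMinusPoly K.frame) X) ++
    (K.antiH.flatMap fun t => pscale t.1 (psub (padj t.2) t.2)) ++
    K.slack

/-- Side conditions: frame without repeats, `0 ∈ frame`, `thicken {0} 1 ⊆ frame`, `inner ⊆ frame`,
`thicken inner 1 ⊆ frame`, `d_k ≥ 0`, supports, licences, nonzero charges. -/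
def wellFormed (K : SymCert) : Bool :=
  nodupSites K.frame && memSite 0 K.frame && subSites (nbhd 0) K.frame && subSites K.inner K.frame &&
    subSites (thick K.inner) K.frame &&
    (K.gram.all fun g => decide (0 ≤ g.1) && psuppIn g.2 K.frame) && (K.gramM.all (gramBlockOK K.frame)) &&
    (K.eom.all fun B => psuppIn B K.inner) &&
    (K.moves.all fun mv => suppIn mv.u K.frame && suppIn (moveWordF mv.γ mv.v mv.u) K.frame) &&
    (K.charged.all fun t => suppIn t.2 K.frame && (wordCharge t.2 != 0 || wordSpinCharge t.2 != 0)) &&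
    (K.wardP.all fun X => psuppIn X K.frame) && (K.wardM.all fun X => psuppIn X K.frame) &&
    (K.antiH.all fun t => psuppIn t.2 K.frame) &&
    (K.slack.all fun t => suppIn t.2 K.frame)

/-- The identity `LHS = RHS` in `𝔄_{Λ'}`, decided syntactically: normal-order `LHS − RHS`, collect,
optionally quotient by the anchored affine-`D₄` canonicaliser (per-word licensed moves), and test for zero. -/
def identityOK (K : SymCert) : Bool :=
  let N := collect (nfPoly (psub (lhsPoly K) (rhsPoly K)))
  let corner := flatSite (minCorner K.frame)
  isZero (if K.useCanon then N.flatMap (canonTermA corner K.frame) else N)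

/-- **The checker.** -/
def symCheck (K : SymCert) : Bool := wellFormed K && identityOK K

/-! ### Toy frames and toy certificates (their kernel checks live in the Sound module) -/

/-- A two-site frame (one bond). -/
def bond2 : List (Site 2) := [0, e1]

/-- The `3 × 3` frame around the origin. -/
def frame3 : List (Site 2) := nbhd 0

/-- **Toy window certificate** (inner region empty, no Ward rows): the SOS identity
`E_Φ + 23/4 + 2 (n_{0↑} + n_{0↓} − 7/8) = 8 (c_↑c_↓)†(c_↑c_↓) + Σ_{y ∈ ±e_i, σ} ½ (c_{0σ} − c_{yσ})†(c_{0σ} − c_{yσ})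
 + Σ_{y, σ} ½ c_{yσ} c†_{yσ}` — value `−23/4`. -/
def toyCert : SymCert where
  frame := frame3
  inner := []
  mu := -2
  c := (-23) / 4
  gram := (8, [(1, [ann 0 0, ann 0 1])]) ::
    ([e1, e2, -e1, -e2].flatMap fun y => ([0, 1] : List (Fin 2)).flatMap fun σ =>
      [(1 / 2, [(1, [ann 0 σ]), (-1, [ann y σ])]), (1 / 2, [(1, [cre y σ])])])
  eom := []
  moves := []
  charged := []
  wardP := []
  wardM := []
  antiH := []
  slack := []
  useCanon := false

/-- The same toy with its Gram shipped in MATRIX form (`gramM`): each weighted SOS factor `d • q†q` as the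
one-column block `(d, words of q, unit coefficient rows)` — the `GramBlock` slot end to end. -/
def toyCertM : SymCert :=
  { toyCert with
    gram := []
    gramM := toyCert.gram.map fun g =>
      { scale := g.1, basis := g.2.map fun t => [(1, t.2)], rows := g.2.map fun t => [(t.1, 0)] } }

/-- The `5 × 5` frame around the origin. -/
def frame5 : List (Site 2) :=
  [(-2 : ℤ), -1, 0, 1, 2].flatMap fun a => [(-2 : ℤ), -1, 0, 1, 2].map fun b => (![a, b] : Site 2)

/-- **Toy certificate using the lever** (`useCanon := true`, inner region `3 × 3`, frame `5 × 5`): the same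
bound `−23/4` from FIVE SOS factors instead of seventeen — the sixteen hopping words of `E_Φ` and the four
bond SOS terms are identified by the licensed affine-`D₄` moves inside the kernel, no `Y`-family shipped:
`E_Φ + 23/4 + 2 (N₀ − 7/8) ≡ 8 (c_↑c_↓)†(c_↑c_↓) + Σ_σ [2 (c_{0σ} − c_{e₁σ})†(c_{0σ} − c_{e₁σ}) + 2 c_{e₁σ} c†_{e₁σ}]`
modulo licensed moves. -/
def toyCanonCert : SymCert where
  frame := frame5
  inner := frame3
  mu := -2
  c := (-23) / 4
  gram := (8, [(1, [ann 0 0, ann 0 1])]) ::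
    (([0, 1] : List (Fin 2)).flatMap fun σ =>
      [(2, [(1, [ann 0 σ]), (-1, [ann e1 σ])]), (2, [(1, [cre e1 σ])])])
  eom := []
  moves := []
  charged := []
  wardP := []
  wardM := []
  antiH := []
  slack := []
  useCanon := true

end Syntax

end Summit.Ventures.CertifiedManyBodySolver.Theorems.SymReplay
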